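import Mathlib.NumberTheory.LSeries.RiemannZeta
import Literature.NumberTheory.LFunctions.DeBruijnNewman
import HarnessLib

/-!
# Named facts: zeros of de Bruijn's `H_t` (route `RiemannHypothesis/DBN`)

Grounder file (D-0014 named facts) for the route `RiemannHypothesis/DBN`.

* `Literature.NumberTheory.LFunctions.ki_kim_lee_finite` (stmt-RiemannHypothesis-0282): for every `t > 0` all but finitely many
  zeros of `H_t` are real (Ki–Kim–Lee, Adv. Math. 222 (2009), Thm. 1.3), phrased as: some
  threshold `T` beyond which (in `|Re z|`) every zero is real. Since the zeros of the entire
  function `H_t` are isolated, "all but finitely many zeros are real" and "all zeros with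
  `|Re z| ≥ T` are real, for some `T`" are equivalent (non-real zeros lie in a bounded strip
  `|Im z| ≤ 1` for `t ≥ 0` by de Bruijn 1950, Thm. 13 / Ki–Kim–Lee §1).
* `Literature.NumberTheory.LFunctions.riemannHypothesis_of_hasOnlyRealZeros_deBruijnH` (stmt-RiemannHypothesis-0276): if `H_t`
  has only real zeros for every `t > 0` then RH holds — de Bruijn 1950 (Thm. 13: real zeros
  persist forward in `t`) with Newman 1976 (Thm. 3: `Λ` exists and `H_t` has only real zeros iff
  `t ≥ Λ`), i.e. `Λ ≤ 0`, and `Λ ≤ 0 ⟺ RH` (Newman 1976, §1; Rodgers–Tao 2020, §1). In the tree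
  this is the composite of the facts `Literature.NumberTheory.LFunctions.deBruijnNewmanConst_le_iff`,
  `Literature.NumberTheory.LFunctions.hasOnlyRealZeros_deBruijnH_iff_deBruijnNewmanConst_le` (Newman closedness, Hurwitz) and
  `Literature.NumberTheory.LFunctions.riemannHypothesis_iff_hasOnlyRealZeros_deBruijnH_zero`; it is recorded as one fact because
  the route's assembly item is typed without those hypotheses.

`H_t = Literature.deBruijnH t` is de Bruijn's `∫₀^∞ e^{tu²} Φ(u) cos(zu) du` (Rodgers–Tao normalisation,
the same as Ki–Kim–Lee's `H_λ`). Nothing is asserted; users take `(h : <name>)`.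

## References

* H. Ki, Y.-O. Kim, J. Lee, *On the de Bruijn–Newman constant*, Adv. Math. 222 (2009), 281–306,
  Thm. 1.3.
* N. G. de Bruijn, *The roots of trigonometric integrals*, Duke Math. J. 17 (1950), 197–226, Thm. 13.
* C. M. Newman, *Fourier transforms with only real zeros*, Proc. AMS 61 (1976), 245–251, Thm. 3.
* B. Rodgers, T. Tao, *The de Bruijn–Newman constant is non-negative*, Forum Math. Pi 8 (2020), §1.
-/

noncomputable section

open Complex

namespace Literature.NumberTheory.LFunctions

/-- NAMED FACT (Ki–Kim–Lee, Adv. Math. 222 (2009), Thm. 1.3: "for every `λ > 0`, all but finitely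
many zeros of `H_λ` are real and simple"). For every `t > 0` there is `T` such that every zero
`z` of `H_t = deBruijnH t` with `|Re z| ≥ T` is real. (The simplicity clause of the printed
theorem is not recorded.) Users take `(h : ki_kim_lee_finite)`. [cite: KiKimLee2009, Thm. 1.3] -/
def ki_kim_lee_finite : Prop :=
  ∀ t : ℝ, 0 < t → ∃ T : ℝ, ∀ z : ℂ, deBruijnH t z = 0 → T ≤ |z.re| → z.im = 0

/-- NAMED FACT (de Bruijn 1950 Thm. 13 with Newman 1976 Thm. 3 and §1: `Λ ≤ 0 ⟺ RH`; cf.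
Rodgers–Tao 2020 §1). If `H_t` has only real zeros for every `t > 0`, then the Riemann hypothesis
holds. In-tree derivation available from the facts `deBruijnNewmanConst_le_iff` (each `t > 0`
gives `Λ ≤ t`, hence `Λ ≤ 0`), `RH.hasOnlyRealZeros_deBruijnH_iff_deBruijnNewmanConst_le` at
`t = 0` (Newman closedness) and `riemannHypothesis_iff_hasOnlyRealZeros_deBruijnH_zero`
(`H_0 = Ξ(·/2)/8`). Users take `(h : riemannHypothesis_of_hasOnlyRealZeros_deBruijnH)`. [cite: Newman1976, Thm. 3 with §1 (and Bruijn1950 Thm. 13)] -/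
def riemannHypothesis_of_hasOnlyRealZeros_deBruijnH : Prop :=
  (∀ t : ℝ, 0 < t → HasOnlyRealZeros (deBruijnH t)) → RiemannHypothesis

end Literature.NumberTheory.LFunctions

end
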